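import Summits.QuantumFields.YangMills.Theses.BackwardLiouvilleRigidity
import Summits.QuantumFields.YangMills.Theorems.BackwardLiouvilleRigidityHeightwiseRealisation
import Literature.MathematicalPhysics.QuantumFieldTheory.Balaban1983to89.BlockAveragingExpMeanLogContinuous

/-!
# BC3 skeleton for the ADMISSIBLE realisation crux `ClassLimitTrajectoriesAdm` (stmt-QuantumFields-23157, rev 5) of route-QuantumFields-BackwardLiouvilleRigidity
(line «backward-liouville-rigidity», ym-r3-idea-1 g12; the rev-4 crux `ClassLimitTrajectories` 22541 stays in the route file as an ASIDE = a consequence, `classLimit_of_adm`).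

Rev 5 couples A♯ to the admissible organ (idea-crit-5 #129a (iii) / #143 (ii)): the realisation crux now DELIVERS `0 < pm` and the certificate
`AdmissibleClassParams F γ b₀ p₀ prm` of the realised parameter schedule (Bałaban's construction realises the printed schedule, admissible by
`BalabanUVClass.printedSchedule_admissible`).  Same two cuts as Lines/backward_liouville_classlimit.lean, re-registered on the new item:
* `stub_heightwiseRealisation` (M/L) — verbatim; ALREADY LANDED as
  `Summit.QuantumFields.YangMills.Theorems.BackwardLiouvilleRigidityHeightwiseRealisation.stub_heightwiseRealisation` (p647757), discharged here by it;
* `stub_fineClassClosureAdm` (XL) — `stub_fineClassClosure` with `0 < pm ∧` and `AdmissibleClassParams F γ b₀ p₀ prm ∧` added to its conclusion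
  (helper lemmas landed `--supports 22541` serve it unchanged; the extra conjunct is read off the printed schedule at the end);
* the kernel-checked composition `classLimitTrajectoriesAdm_of_stubs` (ω := 2ν, the universal parts cancel) concluding the crux BY NAME.
Exactly ONE sorry (the XL stub).  No summit, rung or item is proved here.
-/

namespace Summit.QuantumFields.YangMills.Cruxes.ClassLimitTrajectoriesAdm.BackwardLiouville

/-- atom form of the triangle step: the universal part cancels in the difference of two fine representations. -/
theorem secondDiff_pair (aU aV aW aZ bU bV bW bZ rU rV rW rZ m x : ℝ)
    (h1 : |(aU - rU) - (aV - rV) - ((aW - rW) - (aZ - rZ))| ≤ m * x)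
    (h2 : |(bU - rU) - (bV - rV) - ((bW - rW) - (bZ - rZ))| ≤ m * x) :
    |(aU - bU) - (aV - bV) - ((aW - bW) - (aZ - bZ))| ≤ 2 * m * x := by
  have e : (aU - bU) - (aV - bV) - ((aW - bW) - (aZ - bZ))
      = ((aU - rU) - (aV - rV) - ((aW - rW) - (aZ - rZ))) - ((bU - rU) - (bV - rV) - ((bW - rW) - (bZ - rZ))) := by ring
  rw [e]
  exact (abs_sub _ _).trans (by linarith)

/-- stub (M/L, CLOSED): heightwise compactness of the nested cutoff laws and realisation of the level-0 expectations — the landed theorem, by name. -/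
theorem stub_heightwiseRealisation : open MeasureTheory Filter Topology Literature.MathematicalPhysics.QuantumFieldTheory.Balaban1983to89 T3ContinuumYM3Torus T3NestedUnitLaws T3UnitLawDensityEML T4Continuum BalabanUVClass T3UnitScaleTilt in ∀ (F : T3Family) (γ : ℝ), 0 < γ → ∀ φ : ℕ → ℕ, StrictMono φ → ∃ ψ : ℕ → ℕ, StrictMono ψ ∧ ∃ μ : ((j : ℕ) → MeasureTheory.Measure (GaugeField (F.P j) 0 ↥(Matrix.specialUnitaryGroup (Fin 2) ℂ))), (∀ j : ℕ, IsProbabilityMeasure (μ j)) ∧ (∃ lam : (i j : ℕ) → MeasureTheory.Measure (GaugeField (F.P j) 0 ↥(Matrix.specialUnitaryGroup (Fin 2) ℂ)), (∀ i, lam i ((φ ∘ ψ) i) = T4GenFunBounds.gibbsMeasure (F.P ((φ ∘ ψ) i)) ((F.scheme ℰp γ).β ((φ ∘ ψ) i))) ∧ (∀ i j, j < (φ ∘ ψ) i → lam i j = Measure.map (descend F ℰp j) (lam i (j + 1))) ∧ (∀ (j : ℕ) (f : GaugeField (F.P j) 0 ↥(Matrix.specialUnitaryGroup (Fin 2) ℂ)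 → ℝ), Continuous f → Tendsto (fun i => ∫ U, f U ∂(lam i j)) atTop (𝓝 (∫ U, f U ∂(μ j))))) ∧ (StrictMono (φ ∘ ψ) ∧ ∀ os : List (ULoop3 F), Tendsto (fun i => (F.scheme ℰp γ).expectAt ((φ ∘ ψ) i) os) atTop (𝓝 (∫ u, (os.map fun C => loopAt u (C.1.atLevel 0)).prod ∂(μ 0)))) :=
  Summit.QuantumFields.YangMills.Theorems.BackwardLiouvilleRigidityHeightwiseRealisation.stub_heightwiseRealisation

/-- stub (XL): class closure of heightwise limits with a universal fine part, for an ADMISSIBLE realised parameter schedule (rev-5 coupling). -/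
theorem stub_fineClassClosureAdm : open MeasureTheory Filter Topology Literature.MathematicalPhysics.QuantumFieldTheory.Balaban1983to89 T3ContinuumYM3Torus T3NestedUnitLaws T3UnitLawDensityEML T4Continuum BalabanUVClass T3UnitScaleTilt in ∃ pm : ℝ, 0 < pm ∧ ∀ (p₀ : ℝ), pm ≤ p₀ → ∃ γ₁ : ℝ, 0 < γ₁ ∧ ∀ (F : T3Family) (γ : ℝ), 0 < γ → γ ≤ γ₁ → ∃ (b₀ κ : ℝ) (j₀ : ℕ) (prm : ℕ → ClassParams) (ν η : ℕ → ℝ) (Rf : (j : ℕ) → GaugeField (F.P j) 0 ↥(Matrix.specialUnitaryGroup (Fin 2) ℂ) → ℝ), 0 < b₀ ∧ AdmissibleClassParams F γ b₀ p₀ prm ∧ 0 < κ ∧ (∀ j, 0 ≤ ν j ∧ 0 ≤ η j) ∧ (∀ t : ℝ, 0 < t → ∀ N : ℕ, ∃ J : ℕ, N ≤ J ∧ (J : ℝ) * ν J < t) ∧ Summable η ∧ ∀ (μ : ((j : ℕ) → MeasureTheory.Measure (GaugeField (F.P j) 0 ↥(Matrix.specialUnitaryGroup (Fin 2) ℂ))))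 (χ : ℕ → ℕ), StrictMono χ → (∀ j : ℕ, IsProbabilityMeasure (μ j)) → (∃ lam : (i j : ℕ) → MeasureTheory.Measure (GaugeField (F.P j) 0 ↥(Matrix.specialUnitaryGroup (Fin 2) ℂ)), (∀ i, lam i (χ i) = T4GenFunBounds.gibbsMeasure (F.P (χ i)) ((F.scheme ℰp γ).β (χ i))) ∧ (∀ i j, j < χ i → lam i j = Measure.map (descend F ℰp j) (lam i (j + 1))) ∧ (∀ (j : ℕ) (f : GaugeField (F.P j) 0 ↥(Matrix.specialUnitaryGroup (Fin 2) ℂ) → ℝ), Continuous f → Tendsto (fun i => ∫ U, f U ∂(lam i j)) atTop (𝓝 (∫ U, f U ∂(μ j))))) → (∀ j : ℕ, μ j = Measure.map (descend F ℰp j) (μ (j + 1))) ∧ ∃ ρ : ((j : ℕ) → GaugeField (F.P j) 0 ↥(Matrix.specialUnitaryGroup (Fin 2) ℂ) → ℝ), ∀ j : ℕ, j₀ ≤ j → (∀ U, PlaqSmall (θBal F.L γ b₀ p₀ j) U → 0 < ρ j U) ∧ μ j = (fieldMeasure _ _ _).withDensity (fun U => ENNReal.ofReal (ρ j U)) ∧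 MemAtHeight F ℰp j (prm j) (ρ j) ∧ (∀ (b b' : PBond (F.P j) 0) U V W Z, PlaqSmall (θBal F.L γ b₀ p₀ j) U → PlaqSmall (θBal F.L γ b₀ p₀ j) V → PlaqSmall (θBal F.L γ b₀ p₀ j) W → PlaqSmall (θBal F.L γ b₀ p₀ j) Z → (∀ e, e ≠ b → U e = V e) → (∀ e, e ≠ b' → U e = W e) → (∀ e, e ≠ b' → V e = Z e) → (∀ e, e ≠ b → W e = Z e) → |(Real.log (ρ j U) - Rf j U) - (Real.log (ρ j V) - Rf j V) - ((Real.log (ρ j W) - Rf j W) - (Real.log (ρ j Z) - Rf j Z))| ≤ ν j * Real.exp (-(κ * (b.src.tdist b'.src : ℝ)))) ∧ μ j {U | ¬ PlaqSmall (θBal F.L γ b₀ p₀ j) U} ≤ ENNReal.ofReal (η j) ∧ ContinuousOn (ρ j) {U | PlaqSmall (θBal F.L γ b₀ p₀ j) U} ∧ μ j {U | ¬ PlaqSmall (θBal F.L γ (Real.sqrt b₀) (p₀ / 2) j) U} ≤ ENNReal.ofReal (η j) := by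
  sorry

/-- COMPOSITION (kernel-checked) from the two REGISTERED STUBS BY NAME: `ClassLimitTrajectoriesAdm` (ω := 2ν). -/
theorem classLimitTrajectoriesAdm_of_stubs : Summit.QuantumFields.YangMills.Theses.BackwardLiouvilleRigidity.ClassLimitTrajectoriesAdm := by
  classical
  have h1 := stub_heightwiseRealisation
  obtain ⟨pm, hpm, h2⟩ := stub_fineClassClosureAdm
  refine ⟨pm, hpm, fun p₀ hp => ?_⟩
  obtain ⟨γ₁, hγ₁, h2⟩ := h2 p₀ hp
  refine ⟨γ₁, hγ₁, fun F γ hγ hle => ?_⟩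
  obtain ⟨b₀, κ, j₀, prm, ν, η, Rf, hb₀, hadm, hκ, hpos, hlim, hη, hcl⟩ := h2 F γ hγ hle
  refine ⟨b₀, κ, j₀, prm, fun j => 2 * ν j, η, hb₀, hadm, hκ, fun j => ⟨?_, (hpos j).2⟩, ?_, hη, ?_⟩
  · have := (hpos j).1
    beta_reduce
    linarith
  · intro t ht N
    obtain ⟨J, hNJ, hJ⟩ := hlim (t / 2) (by linarith) N
    refine ⟨J, hNJ, ?_⟩
    beta_reduce
    have e : (J : ℝ) * (2 * ν J) = 2 * ((J : ℝ) * ν J) := by ring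
    rw [e]
    linarith
  · intro φ φ' hφ hφ'
    obtain ⟨ψ, hψ, μ, hμP, hμW, hμR⟩ := h1 F γ hγ φ hφ
    obtain ⟨ψ', hψ', μ', hμ'P, hμ'W, hμ'R⟩ := h1 F γ hγ φ' hφ'
    obtain ⟨hμC, ρ, hρ⟩ := hcl μ (φ ∘ ψ) (hφ.comp hψ) hμP hμW
    obtain ⟨hμ'C, ρ', hρ'⟩ := hcl μ' (φ' ∘ ψ') (hφ'.comp hψ') hμ'P hμ'W
    refine ⟨ψ, ψ', hψ, hψ', μ, μ', ρ, ρ', fun j => ⟨hμP j, hμC j⟩, fun j => ⟨hμ'P j, hμ'C j⟩, hμR, hμ'R, ?_, ?_⟩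
    · intro j hj
      obtain ⟨hp, hd, hm, hf, ht, hco, hin⟩ := hρ j hj
      obtain ⟨hp', hd', hm', hf', ht', hco', hin'⟩ := hρ' j hj
      refine ⟨fun U hU => ⟨hp U hU, hp' U hU⟩, hd, hd', hm, hm', ?_, ht, ht', hco, hco'⟩
      intro b b' U V W Z hU hV hW hZ e1 e2 e3 e4
      have f1 := hf b b' U V W Z hU hV hW hZ e1 e2 e3 e4
      have f2 := hf' b b' U V W Z hU hV hW hZ e1 e2 e3 e4
      beta_reduce
      exact secondDiff_pair _ _ _ _ _ _ _ _ _ _ _ _ _ _ f1 f2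
    · intro j hj
      exact ⟨(hρ j hj).2.2.2.2.2.2, (hρ' j hj).2.2.2.2.2.2⟩

end Summit.QuantumFields.YangMills.Cruxes.ClassLimitTrajectoriesAdm.BackwardLiouville
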